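import Summits.KontsevichZagierPeriods.Zeta5Search.Certificates.RayH1CoeffAsymp
import Summits.KontsevichZagierPeriods.Zeta5Search.Certificates.RayH1Stirling
import Summits.KontsevichZagierPeriods.Zeta5Search.Certificates.RayH1DualFinalE0
import Summits.KontsevichZagierPeriods.Zeta5Search.Certificates.RayH1DualFinalE1
import Summits.KontsevichZagierPeriods.Zeta5Search.Certificates.RayH1GrowthSharp
import Summits.KontsevichZagierPeriods.Zeta5Search.Certificates.RecordRayExponent
import HarnessLib

/-!
# ζ(5) search — certificates: the ray RayH1 DECAYS — `|L_n| ≤ e^{(-27.3999+ε)n}` unconditionally, and its effective exponent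
(cell `pub-zeta5`, P1 g11; port of certifier 2's `Certificates/RecordRayDecay.lean` + `RecordRayExponent.record_exponent`)

HONEST FRAMING: systematic search; no irrationality claim unless certified. Nothing here is a statement about the arithmetic
nature of `ζ(5)`: an effective exponent `γ < 1` is a calibration of explicit approximations (Dirichlet gives `2` for free).

OUR work (Summit side). `L_n = ρ(a·n)·(W(b′)F̃₇(b) − W(b)F̃₇(b′)) = Q(a·n)ζ(5) − P_n` (`RayH1Forms.h1Form_eq`):
* `eventually_rho_termNorm_H1_le_exp` — `|ρ(a·n)|·Z_n ≤ e^{50·n·log n + (95.5886+ε)n}` (`RayH1Stirling`: `139.258 -43.6694`),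
  and the same with the partner normaliser `Z(b′) = Z(b)(18n+1)(18n)`;
* `eventually_first/second_wedge_term_H1_le_exp` — both wedge terms `≤ e^{(-27.3999+ε)n}`: the `n log n` terms cancel
  (`50 − 50 + 0`), the rates add up to `95.5886 -17.24 -105.7485 = -27.3999` (census MODEL C₀ = -27.409);
* **`eventually_h1Form_le_exp`** — for every `ε > 0`, eventually `|L_n| ≤ e^{(-27.3999 + ε)·n}`;
* **`h1_exponent`** — given denominators `D_n` (`D_nP_n ∈ ℤ`, `0 < D_n ≤ e^{λn}` eventually; the cell's ladder, HYPOTHESIS here),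
  every `γ ≥ 0` with `γ(λ + 72.9346) < 72.9343 + 27.3999` is an effective exponent:
  eventually `|ζ(5) − P_n/Q(a·n)| < 1/q_n^γ`, `q_n = D_n|Q(a·n)|`, `p_n = D_nP_n ∈ ℤ`. The tie with Brown–Zudilin's `γ = 0.86597135`
  is at `λ* = 42.929` nats/step: ANY proved denominator rate below it on this ray beats the printed record exponent
  (instances `h1_exponent_rate_*`).
-/

noncomputable section

open Finset Real Filter Topology

namespace Summit.KontsevichZagierPeriods.Zeta5Search.RayH1

open Summit.KontsevichZagierPeriods.Zeta5Search.DualSeries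
open Summit.KontsevichZagierPeriods.Zeta5Search.DualSeriesBounds
open Summit.KontsevichZagierPeriods.Zeta5Search.WedgeDictionary
open Summit.KontsevichZagierPeriods.Zeta5Search.RecordRay (eventually_log_linear_le abs_sub_div_lt_of_bounds)
open Literature.NumberTheory.Transcendental (zetaValue)
open Literature.NumberTheory.Irrationality.BrownZudilin2022 (vwpDual)

/-- **Rate form of the Stirling bookkeeping**: for every `ε > 0`, eventually
`|ρ(a·n)|·Z(b) ≤ e^{50·n·log n + (95.5886 + ε)·n}` and the same for `Z(b′)`. -/
theorem eventually_rho_termNorm_H1_le_exp {ε : ℝ} (hε : 0 < ε) :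
    ∀ᶠ n : ℕ in atTop, |(rhoOf (aH1 n) : ℝ)| * termNorm (34 * n) (BH1E 0 n) ≤
        Real.exp (50 * n * Real.log n + (477943 / 5000 + ε) * n) ∧
      |(rhoOf (aH1 n) : ℝ)| * termNorm (34 * n) (BH1E 1 n) ≤
        Real.exp (50 * n * Real.log n + (477943 / 5000 + ε) * n) := by
  filter_upwards [eventually_ge_atTop 1,
    eventually_log_linear_le (a := 119) (b := 0) (by norm_num) le_rfl (show (0 : ℝ) < ε / 64 by positivity),
    eventually_log_linear_le (a := 243) (b := 0) (by norm_num) le_rfl (show (0 : ℝ) < ε / 16 by positivity),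
    eventually_log_linear_le (a := 19) (b := 0) (by norm_num) le_rfl (show (0 : ℝ) < ε / 16 by positivity),
    tendsto_natCast_atTop_atTop.eventually_ge_atTop (12 / ε)] with n hn hKR hKZ h46 hbig
  have hb : (12 : ℝ) ≤ ε * n := by rwa [div_le_iff₀ hε, mul_comm] at hbig
  rw [add_zero] at hKR hKZ h46
  have hnR : (1 : ℝ) ≤ n := by exact_mod_cast hn
  have hZ := termNorm_pos (34 * n) (BH1E 0 n)
  have hρ := log_abs_rhoOf_aH1_le hn
  have hZl := log_termNorm_H1_le hn
  have hpartner := termNorm_H1_partner hn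
  -- the partner factor `(18n+1)(18n) ≤ (19n)^2`
  have hfac : (18 * (n : ℝ) + 1) * (18 * n) ≤ Real.exp (2 * Real.log (19 * n)) := by
    rw [show (2 : ℝ) * Real.log (19 * n) = Real.log ((19 * n) ^ 2) by rw [Real.log_pow]; norm_num,
      Real.exp_log (by positivity)]
    nlinarith
  have hfac0 : (0 : ℝ) ≤ (18 * (n : ℝ) + 1) * (18 * n) := by positivity
  rcases (abs_nonneg (rhoOf (aH1 n) : ℝ)).eq_or_lt with h0 | hpos
  · rw [← h0, zero_mul, zero_mul]; exact ⟨(Real.exp_pos _).le, (Real.exp_pos _).le⟩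
  have h1 : |(rhoOf (aH1 n) : ℝ)| * termNorm (34 * n) (BH1E 0 n) ≤
      Real.exp (50 * n * Real.log n + (477943 / 5000 + ε / 2) * n) := by
    rw [← Real.exp_log hpos, ← Real.exp_log hZ, ← Real.exp_add]
    apply Real.exp_le_exp.2
    nlinarith
  constructor
  · refine h1.trans (Real.exp_le_exp.2 ?_); nlinarith
  · rw [hpartner, ← mul_assoc]
    calc |(rhoOf (aH1 n) : ℝ)| * termNorm (34 * n) (BH1E 0 n) * ((18 * (n : ℝ) + 1) * (18 * n))
        ≤ Real.exp (50 * n * Real.log n + (477943 / 5000 + ε / 2) * n) * Real.exp (2 * Real.log (19 * n)) :=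
          mul_le_mul h1 hfac hfac0 (Real.exp_pos _).le
      _ = Real.exp (50 * n * Real.log n + (477943 / 5000 + ε / 2) * n + 2 * Real.log (19 * n)) := by rw [← Real.exp_add]
      _ ≤ Real.exp (50 * n * Real.log n + (477943 / 5000 + ε) * n) := by apply Real.exp_le_exp.2; nlinarith

/-- **THE FIRST WEDGE TERM DECAYS AT RATE `-27.3999`**: for every `ε > 0`, eventually
`|ρ(a·n)|·|W(b′)|·F̃₇(b) ≤ e^{(-27.3999 + ε)·n}`. -/
theorem eventually_first_wedge_term_H1_le_exp {ε : ℝ} (hε : 0 < ε) :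
    ∀ᶠ n : ℕ in atTop, |(rhoOf (aH1 n) : ℝ)| * |(coeffW (bH1' n) : ℝ)| * vwpDual 7 (bH1 n) ≤
      Real.exp ((-273999 / 10000 + ε) * n) := by
  have hε3 : 0 < ε / 3 := by positivity
  filter_upwards [eventually_rho_termNorm_H1_le_exp hε3,
    eventually_coeffW_h1_le_exp hε3, eventually_vwpDual_h1E0_le_exp hε3] with n hρZ hW hF
  obtain ⟨hρZ0, -⟩ := hρZ
  obtain ⟨-, hW'⟩ := hW
  have hρ0 : 0 ≤ |(rhoOf (aH1 n) : ℝ)| := abs_nonneg _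
  have hW0 : 0 ≤ |(coeffW (bH1' n) : ℝ)| := abs_nonneg _
  have hFZ : vwpDual 7 (bH1 n) ≤ termNorm (34 * n) (BH1E 0 n) * Real.exp ((-211497 / 2000 + ε / 3) * n) := hF
  calc |(rhoOf (aH1 n) : ℝ)| * |(coeffW (bH1' n) : ℝ)| * vwpDual 7 (bH1 n)
      ≤ |(rhoOf (aH1 n) : ℝ)| * |(coeffW (bH1' n) : ℝ)| *
          (termNorm (34 * n) (BH1E 0 n) * Real.exp ((-211497 / 2000 + ε / 3) * n)) :=
        mul_le_mul_of_nonneg_left hFZ (mul_nonneg hρ0 hW0)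
    _ = (|(rhoOf (aH1 n) : ℝ)| * termNorm (34 * n) (BH1E 0 n)) * |(coeffW (bH1' n) : ℝ)| *
          Real.exp ((-211497 / 2000 + ε / 3) * n) := by ring
    _ ≤ Real.exp (50 * n * Real.log n + (477943 / 5000 + ε / 3) * n) *
          Real.exp (-50 * n * Real.log n + (-(431 / 25) + ε / 3) * n) *
          Real.exp ((-211497 / 2000 + ε / 3) * n) := by
        apply mul_le_mul_of_nonneg_right _ (Real.exp_pos _).le
        exact mul_le_mul hρZ0 hW' hW0 (Real.exp_pos _).le
    _ = Real.exp ((-273999 / 10000 + ε) * n) := by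
        rw [← Real.exp_add, ← Real.exp_add]
        congr 1
        ring

/-- **THE SECOND WEDGE TERM DECAYS AT RATE `-27.3999`**: for every `ε > 0`, eventually
`|ρ(a·n)|·|W(b)|·F̃₇(b′) ≤ e^{(-27.3999 + ε)·n}`. -/
theorem eventually_second_wedge_term_H1_le_exp {ε : ℝ} (hε : 0 < ε) :
    ∀ᶠ n : ℕ in atTop, |(rhoOf (aH1 n) : ℝ)| * |(coeffW (bH1 n) : ℝ)| * vwpDual 7 (bH1' n) ≤
      Real.exp ((-273999 / 10000 + ε) * n) := by
  have hε3 : 0 < ε / 3 := by positivity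
  filter_upwards [eventually_rho_termNorm_H1_le_exp hε3,
    eventually_coeffW_h1_le_exp hε3, eventually_vwpDual_h1E1_le_exp hε3] with n hρZ hW hF
  obtain ⟨-, hρZ1⟩ := hρZ
  obtain ⟨hW', -⟩ := hW
  have hρ0 : 0 ≤ |(rhoOf (aH1 n) : ℝ)| := abs_nonneg _
  have hW0 : 0 ≤ |(coeffW (bH1 n) : ℝ)| := abs_nonneg _
  have hFZ : vwpDual 7 (bH1' n) ≤ termNorm (34 * n) (BH1E 1 n) * Real.exp ((-211497 / 2000 + ε / 3) * n) := hF
  calc |(rhoOf (aH1 n) : ℝ)| * |(coeffW (bH1 n) : ℝ)| * vwpDual 7 (bH1' n)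
      ≤ |(rhoOf (aH1 n) : ℝ)| * |(coeffW (bH1 n) : ℝ)| *
          (termNorm (34 * n) (BH1E 1 n) * Real.exp ((-211497 / 2000 + ε / 3) * n)) :=
        mul_le_mul_of_nonneg_left hFZ (mul_nonneg hρ0 hW0)
    _ = (|(rhoOf (aH1 n) : ℝ)| * termNorm (34 * n) (BH1E 1 n)) * |(coeffW (bH1 n) : ℝ)| *
          Real.exp ((-211497 / 2000 + ε / 3) * n) := by ring
    _ ≤ Real.exp (50 * n * Real.log n + (477943 / 5000 + ε / 3) * n) *
          Real.exp (-50 * n * Real.log n + (-(431 / 25) + ε / 3) * n) *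
          Real.exp ((-211497 / 2000 + ε / 3) * n) := by
        apply mul_le_mul_of_nonneg_right _ (Real.exp_pos _).le
        exact mul_le_mul hρZ1 hW' hW0 (Real.exp_pos _).le
    _ = Real.exp ((-273999 / 10000 + ε) * n) := by
        rw [← Real.exp_add, ← Real.exp_add]
        congr 1
        ring

/-- **THE RAY DECAYS: `|L_n| ≤ e^{(-27.3999 + ε)·n}` eventually, for every `ε > 0`.** -/
theorem eventually_h1Form_le_exp {ε : ℝ} (hε : 0 < ε) :
    ∀ᶠ n : ℕ in atTop, |h1Form n| ≤ Real.exp ((-273999 / 10000 + ε) * n) := by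
  have hε2 : 0 < ε / 2 := by positivity
  filter_upwards [eventually_ge_atTop 1, eventually_first_wedge_term_H1_le_exp hε2,
    eventually_second_wedge_term_H1_le_exp hε2, tendsto_natCast_atTop_atTop.eventually_ge_atTop (2 / ε)]
    with n hn h1 h2 hbig
  have hb : (2 : ℝ) ≤ ε * n := by rwa [div_le_iff₀ hε, mul_comm] at hbig
  have hF0 : 0 ≤ vwpDual 7 (bH1 n) := (vwpDual_h1_pos n).le
  have hF0' : 0 ≤ vwpDual 7 (bH1' n) :=
    (vwpDual_seven_pos (hle_h1E (e := 1) le_rfl hn) (hsum_h1E (e := 1) le_rfl)).le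
  have habs : |h1Form n| ≤ |(rhoOf (aH1 n) : ℝ)| * |(coeffW (bH1' n) : ℝ)| * vwpDual 7 (bH1 n) +
      |(rhoOf (aH1 n) : ℝ)| * |(coeffW (bH1 n) : ℝ)| * vwpDual 7 (bH1' n) := by
    unfold h1Form
    rw [abs_mul]
    have h := abs_sub ((coeffW (bH1' n) : ℝ) * vwpDual 7 (bH1 n)) ((coeffW (bH1 n) : ℝ) * vwpDual 7 (bH1' n))
    rw [abs_mul, abs_mul, abs_of_nonneg hF0, abs_of_nonneg hF0'] at h
    have hρ0 : 0 ≤ |(rhoOf (aH1 n) : ℝ)| := abs_nonneg _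
    nlinarith
  have htwo : (2 : ℝ) * Real.exp ((-273999 / 10000 + ε / 2) * n) ≤ Real.exp ((-273999 / 10000 + ε) * n) := by
    have h2 : (2 : ℝ) ≤ Real.exp (ε / 2 * n) := by
      have := Real.add_one_le_exp (ε / 2 * n); nlinarith
    calc (2 : ℝ) * Real.exp ((-273999 / 10000 + ε / 2) * n)
        ≤ Real.exp (ε / 2 * n) * Real.exp ((-273999 / 10000 + ε / 2) * n) :=
          mul_le_mul_of_nonneg_right h2 (Real.exp_pos _).le
      _ = Real.exp ((-273999 / 10000 + ε) * n) := by rw [← Real.exp_add]; congr 1; ring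
  linarith

/-! ### The effective exponent -/

/-- **The ray's effective exponent.** PROVED here: the form identity, the growth `e^{(72.9343−ε)n} ≤ |Q(a·n)| ≤ e^{(72.9346+ε)n}`
and the decay `|L_n| ≤ e^{(-27.3999+ε)n}`. HYPOTHESIS (HD): denominators `D_n` with `D_nP_n ∈ ℤ`, `0 < D_n ≤ e^{λn}` eventually.
CONCLUSION: for every `γ ≥ 0` with `γ(λ + 72.9346) < 72.9343 + 27.3999`, eventually there are integers
`p_n = D_nP_n`, `q_n = D_n|Q(a·n)| ≥ 1` with `|ζ(5) − P_n/Q(a·n)| < 1/q_n^γ`. -/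
theorem h1_exponent {lam γ : ℝ} (D : ℕ → ℕ)
    (hD : ∀ᶠ n : ℕ in atTop, 0 < D n ∧ (∃ z : ℤ, (D n : ℚ) * h1P n = z) ∧ (D n : ℝ) ≤ Real.exp (lam * n))
    (hγ : 0 ≤ γ) (hrate : γ * (lam + 364673 / 5000) < 729343 / 10000 - (-273999 / 10000)) :
    ∀ᶠ n : ℕ in atTop, ∃ p : ℤ, ∃ q : ℕ, 1 ≤ q ∧ (q : ℤ) = D n * |h1Q n| ∧ (p : ℚ) = D n * h1P n ∧
      |zetaValue 5 - (h1P n : ℝ) / (h1Q n : ℝ)| < 1 / (q : ℝ) ^ γ := by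
  obtain ⟨ε, hε, hrate'⟩ : ∃ ε : ℝ, 0 < ε ∧
      γ * (lam + (364673 / 5000 + ε)) < (729343 / 10000 - ε) - ((-273999 / 10000) + ε) := by
    refine ⟨(729343 / 10000 - (-273999 / 10000) - γ * (lam + 364673 / 5000)) / (2 * (γ + 2)), ?_, ?_⟩
    · apply div_pos (by linarith) (by positivity)
    · have hg1 : 0 < γ + 2 := by linarith
      field_simp
      nlinarith
  have hform : ∀ᶠ n : ℕ in atTop, |(h1Q n : ℝ) * zetaValue 5 - (h1P n : ℝ)| ≤ Real.exp (((-273999 / 10000) + ε) * n) := by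
    filter_upwards [eventually_h1Form_le_exp hε, eventually_ge_atTop 1] with n hn hn1
    rwa [h1Form_eq hn1] at hn
  have hD' : ∀ᶠ n : ℕ in atTop, 0 < (D n : ℝ) ∧ (D n : ℝ) ≤ Real.exp (lam * n) := by
    filter_upwards [hD] with n hn; exact ⟨by exact_mod_cast hn.1, hn.2.2⟩
  have key := abs_sub_div_lt_of_bounds (ξ := zetaValue 5) (Q := fun n => (h1Q n : ℝ)) (P := fun n => (h1P n : ℝ))
    (D := fun n => (D n : ℝ)) hform (eventually_exp_le_abs_h1Q_sharp hε) (eventually_abs_h1Q_le_exp hε) hD' hγ hrate'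
  filter_upwards [key, hD] with n hn hDn
  obtain ⟨hDpos, ⟨z, hz⟩, -⟩ := hDn
  refine ⟨z, D n * (h1Q n).natAbs, ?_, ?_, hz.symm, ?_⟩
  · have hQ : h1Q n ≠ 0 := by
      have := (latticeTerm_le_abs_h1Q n).2
      intro h; rw [h] at this; simp at this
    exact Nat.one_le_iff_ne_zero.mpr (Nat.mul_ne_zero hDpos.ne' (Int.natAbs_ne_zero.mpr hQ))
  · simp
  · have hcast : ((D n * (h1Q n).natAbs : ℕ) : ℝ) = (D n : ℝ) * |(h1Q n : ℝ)| := by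
      push_cast; rw [Nat.cast_natAbs, Int.cast_abs]
    rw [hcast]
    exact hn

/-- With the CERTIFIED rates of this chain and a denominator rate `λ = 43.146` (plus32), every `γ ≤ 0.8643` satisfies
the rate condition of `h1_exponent` (supremum `0.86435`; Brown–Zudilin's record worthiness is `0.86597135`). -/
theorem h1_exponent_rate_plus32 {γ : ℝ} (hγ : γ ≤ 8643 / 10000) :
    γ * (21573 / 500 + 364673 / 5000) < 729343 / 10000 - ((-273999 / 10000 : ℝ)) := by
  nlinarith

/-- With the CERTIFIED rates of this chain and a denominator rate `λ = 42.967` (plus32U), every `γ ≤ 0.8656` satisfies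
the rate condition of `h1_exponent` (supremum `0.86568`; Brown–Zudilin's record worthiness is `0.86597135`). -/
theorem h1_exponent_rate_plus32U {γ : ℝ} (hγ : γ ≤ 541 / 625) :
    γ * (42967 / 1000 + 364673 / 5000) < 729343 / 10000 - ((-273999 / 10000 : ℝ)) := by
  nlinarith

/-- With the CERTIFIED rates of this chain and a denominator rate `λ = 42.898` (lettersAll), every `γ ≤ 0.8662` satisfies
the rate condition of `h1_exponent` (supremum `0.86620`; Brown–Zudilin's record worthiness is `0.86597135`). -/
theorem h1_exponent_rate_lettersAll {γ : ℝ} (hγ : γ ≤ 4331 / 5000) :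
    γ * (21449 / 500 + 364673 / 5000) < 729343 / 10000 - ((-273999 / 10000 : ℝ)) := by
  nlinarith

/-- With the CERTIFIED rates of this chain and a denominator rate `λ = 42.521` (BZ2830), every `γ ≤ 0.869` satisfies
the rate condition of `h1_exponent` (supremum `0.86903`; Brown–Zudilin's record worthiness is `0.86597135`). -/
theorem h1_exponent_rate_BZ2830 {γ : ℝ} (hγ : γ ≤ 869 / 1000) :
    γ * (42521 / 1000 + 364673 / 5000) < 729343 / 10000 - ((-273999 / 10000 : ℝ)) := by
  nlinarith

end Summit.KontsevichZagierPeriods.Zeta5Search.RayH1
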